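import Literature.AlgebraicGeometry.ModuliOfAbelianVarieties.SiegelFramedCovariant
import Literature.AlgebraicGeometry.Morphisms.PushforwardFrameBaseChange
import Literature.AlgebraicGeometry.AbelianSchemes.AbelianSchemeLDeltaBaseChange
import Literature.AlgebraicGeometry.AbelianSchemes.PolarizedAbelianSchemeWithLevelBaseChangeCancel
import Literature.AlgebraicGeometry.AbelianSchemes.AbelianSchemeLDeltaFibreH1Vanishing
import HarnessLib

/-!
# Linear rigidifications PULL BACK along the moduli relation (F-DAG F-8, the (hBC) input of (8β)/(8γ))

Topic `AlgebraicGeometry/ModuliOfAbelianVarieties`; namespace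
`Literature.AlgebraicGeometry.AbelianSchemes.PolarizedAbelianSchemeWithLevel`.  THEOREMS ONLY (no definition, no named
fact, no instance, no notation, no `sorry`).  Cell `hodgecm-mathlib` (D-0151), F-DAG leaf F-8 «the quotient `A⁰ := H ∕ GL_{m+1}`
by slices»: the input (hBC) of the sub-functor file (8β-b) `ModuliOfAbelianVarieties/SiegelModuliFrameSubfunctor`
(`preimage_frameOpen`, `IsFrameOn.of_isBaseChangeVia`) and of the uniqueness half (8γ-U) (`exists_openCover_GL_of_isLinearRigidification`),
over the interface ★ (8α) `ModuliOfAbelianVarieties/SiegelFramedCovariant` (`IsFrameRigidification`, `IsLinearRigidification`).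
Count-neutral: HC_CM is proved only modulo the 7 printed citations until rung 0 closes — nothing here bears on a summit statement.

[MumfordFogartyKirwan1994] Ch. 7 §2: Def. 7.2 (p. 129) makes polarised abelian schemes with level structure «a contravariant
functor … in the obvious way» (`(X, λ, σ) ↦ (X ×_S T, λ_T, σ_T)`), and Def. 7.5 (p. 130) / Prop. 7.6 (p. 136) add a LINEAR
RIGIDIFICATION `ℙ(π_*L^Δ(λ)³) ≅ ℙ^m × S`, which pulls back with the triple because `π_*(L^Δ(λ)³)` is locally free of rank `m + 1`
and «commutes with base change» (Prop. 6.13 (p. 123), [MumfordAV1970] §5 Cor. 3).  In the tree a linear rigidification is recorded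
by the embedding `ι : X → 𝐏^m_ℤ` it defines (★ (8α) §1), and the pull-back of `(P, ι)` along a relation
`P″.IsBaseChangeVia P u G Ĝ` is `(P″, G ≫ ι)`.

* §1 **`IsBaseChangeVia.isFrameRigidification_comp`** — GLOBAL frames pull back: if `ι` is the morphism of a frame
  `e : 𝒪_T^{m+1} ≅ π_*(L^Δ(λ)^{⊗3})` (`P.IsFrameRigidification J ι`, `T` locally Noetherian) and `(G, Ĝ)` exhibits `P″` over `T″` as the
  pull-back of `P` along `u : T″ → T`, then `G ≫ ι` is the morphism of a frame of `π″_*(L^Δ(λ″)^{⊗3})` — the generic transport ★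
  `Morphisms.exists_frame_homEquiv_pointOfSections_eq_comp` (cohomology and base change for the framed direct image, fed with ★ V4
  `Polarization.subsingleton_ext_one_pullback_LDelta_tensorPow'`) along the cartesian square of the relation, across the module
  isomorphism `G^*(L^Δ(λ)^{⊗3}) ≅ L^Δ(λ″)^{⊗3}` (★ `IsBaseChangeVia.nonempty_iso_pullback_LDelta`, ★ `nonempty_pullback_tensorPow_iso`);
  `IsFrameRigidification.baseChange` — the case of the chosen base change `P.baseChange v` (e.g. restriction to an open `v = U.ι`).
* §2 **`IsBaseChangeVia.isLinearRigidification_comp`** — (hBC) VERBATIM: LINEAR rigidifications (Zariski-local frames) pull back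
  along relations (pull the cover back, Mathlib `Scheme.Cover.pullback₁`; compare the restricted triples by ★
  `exists_isBaseChangeVia_of_comp`; §1 on each member); `IsLinearRigidification.baseChange`;
  `IsFrameRigidification.isLinearRigidification` (the one-member cover); **`IsLinearRigidification.of_openCover`** — being a linear
  rigidification is Zariski-LOCAL on the base (refine the covers; the input of the (8γ) existence gluing).

## References
* [MumfordFogartyKirwan1994] D. Mumford, J. Fogarty, F. Kirwan, *Geometric Invariant Theory*, 3rd ed. (1994), Ch. 7 §2 Def. 7.2
  (p. 129), Def. 7.5 (p. 130), Prop. 7.6 (p. 136); Ch. 6 §2 Prop. 6.13 (p. 123).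
* [MumfordAV1970] D. Mumford, *Abelian Varieties* (1970), §5 Cor. 3 (p. 53).
* [Hartshorne1977] R. Hartshorne, *Algebraic Geometry* (1977), II Thm. 7.1 (p. 150).
-/

noncomputable section

-- Mathlib's `Over`/pull-back API and `Scheme.Modules` section API are stated across semireducible wrappers (as in ★ (8α)).
set_option backward.isDefEq.respectTransparency false

open CategoryTheory CategoryTheory.Limits AlgebraicGeometry
open Literature.AlgebraicGeometry.Modules
open Literature.AlgebraicGeometry.Motives Literature.AlgebraicGeometry.Motives.GeneratingSections
open Literature.AlgebraicGeometry.Morphisms Literature.AlgebraicGeometry.AbelianVarieties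

namespace Literature.AlgebraicGeometry.AbelianSchemes

namespace PolarizedAbelianSchemeWithLevel

variable {g N : ℕ} {δ : Fin g → ℕ} (J : Type)

/-- `M ≅ M′ ⟹ M^{⊗n} ≅ M′^{⊗n}` (plumbing; the device of ★ `DualIsogenyMulN`). [cite: MumfordAV1970, §5 Cor. 3 (p. 53)] -/
private theorem nonempty_tensorPow_iso_of_iso'' {X : Scheme.{0}} {M M' : X.Modules} (e : M ≅ M') :
    ∀ n : ℕ, Nonempty (tensorPow M n ≅ tensorPow M' n)
  | 0 => ⟨Iso.refl _⟩
  | n + 1 => (nonempty_tensorPow_iso_of_iso'' e n).map fun i => tensorMapIso i e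

/-! ## §1 Global frames pull back along a relation -/

section Frame

variable {J} {T T'' : Scheme.{0}} [IsLocallyNoetherian T] {P : PolarizedAbelianSchemeWithLevel g N δ T}
  {P'' : PolarizedAbelianSchemeWithLevel g N δ T''} {u : T'' ⟶ T} {G : P''.A.X.left ⟶ P.A.X.left}
  {Ĝ : P''.D.hat.X.left ⟶ P.D.hat.X.left} {ι : P.A.X.left ⟶ projectiveSpaceInt J}

/-- **GLOBAL FRAME RIGIDIFICATIONS PULL BACK ALONG THE MODULI RELATION** ([MumfordFogartyKirwan1994] Def. 7.2 «in the obvious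
way» + Def. 7.5): if `ι : X → 𝐏^m_ℤ` is the morphism of a frame `e : 𝒪_T^{m+1} ≅ π_*(L^Δ(λ)^{⊗3})` of the triple `P` over a locally
Noetherian `T`, and `(G, Ĝ)` exhibits `P″` over `T″` as the pull-back of `P` along `u : T″ → T`, then `G ≫ ι` is the morphism of a
frame of `π″_*(L^Δ(λ″)^{⊗3})`: the graph `Gr″ = (1, λ″)`, the frame system `F` pulled back along `G` and moved across
`φ : G^*(L^Δ(λ)^{⊗3}) ≅ L^Δ(λ″)^{⊗3}` (★ `IsBaseChangeVia.nonempty_iso_pullback_LDelta`, ★ `nonempty_pullback_tensorPow_iso`), and the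
transported frame `e″` of ★ `Morphisms.exists_frame_homEquiv_pointOfSections_eq_comp` (cohomology and base change for the framed
`π_*(L^Δ(λ)^{⊗3})` along the cartesian square of the relation; `H¹ = 0` on fibres by ★ V4
`Polarization.subsingleton_ext_one_pullback_LDelta_tensorPow'`), whose point of `𝐏^m` is `G ≫ ι`.
[cite: MumfordFogartyKirwan1994, Ch. 7 §2 Def. 7.5 (p. 130) and Prop. 7.6 (p. 136)] [cite: MumfordAV1970, §5 Cor. 3 (p. 53)] -/
theorem IsBaseChangeVia.isFrameRigidification_comp (h : P''.IsBaseChangeVia P u G Ĝ)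
    (hι : P.IsFrameRigidification J ι) : P''.IsFrameRigidification J (G ≫ ι) := by
  obtain ⟨Gr, hGr₁, hGr₂, F, h1, e, hcov, hιeq⟩ := hι
  -- the graph `Gr″ = (1, λ″)` of `P″`
  let Gr'' : P''.A.X.left ⟶ P''.A.prodLeft P''.D.hat :=
    pullback.lift (𝟙 _) P''.pol.lam.left (by rw [Category.id_comp]; exact (Over.w P''.pol.lam).symm)
  have hGr''₁ : Gr'' ≫ pullback.fst P''.A.X.hom P''.D.hat.X.hom = 𝟙 _ := pullback.lift_fst _ _ _
  have hGr''₂ : Gr'' ≫ pullback.snd P''.A.X.hom P''.D.hat.X.hom = P''.pol.lam.left := pullback.lift_snd _ _ _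
  -- `φ : G^*(L^Δ(λ)^{⊗3}) ≅ L^Δ(λ″)^{⊗3}`
  obtain ⟨ψ⟩ := h.nonempty_iso_pullback_LDelta Gr hGr₁ hGr₂ Gr'' hGr''₁ hGr''₂
  have hL1 : HasRank ((Scheme.Modules.pullback Gr).obj P.D.P) 1 := hasRank_pullback Gr P.D.hasRank_one
  obtain ⟨τ⟩ := nonempty_pullback_tensorPow_iso (M := (Scheme.Modules.pullback Gr).obj P.D.P) G hL1 3
  obtain ⟨σ⟩ := nonempty_tensorPow_iso_of_iso'' ψ 3
  let φ : (Scheme.Modules.pullback G).obj (tensorPow ((Scheme.Modules.pullback Gr).obj P.D.P) 3) ≅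
      tensorPow ((Scheme.Modules.pullback Gr'').obj P''.D.P) 3 := τ ≪≫ σ
  -- the frame system `F` pulled back along `G` and moved across `φ` (structure literal, as in ★ (W))
  have h1G : ∀ x, (F.pullback G).rank x = 1 := fun x ↦ h1 (G.base x)
  let Fφ : FrameSystem (tensorPow ((Scheme.Modules.pullback Gr'').obj P''.D.P) 3) :=
    { U := (F.pullback G).U, mem := (F.pullback G).mem, I := (F.pullback G).I, rank := (F.pullback G).rank,
      enum := (F.pullback G).enum,
      frame := fun x => (F.pullback G).frame x ≪≫ (SheafOfModules.overFunctor _ ((F.pullback G).U x)).mapIso φ }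
  have h1φ : ∀ x, Fφ.rank x = 1 := h1G
  -- the cartesian square of the relation and the fibrewise `H¹ = 0`
  obtain ⟨-, hpb, -, -⟩ := h.1.1
  haveI : IsProper P.A.X.hom := P.A.isProper
  haveI : Smooth P.A.X.hom := P.A.isSmooth
  obtain ⟨e'', hcov'', heq⟩ := Morphisms.exists_frame_homEquiv_pointOfSections_eq_comp P.A.X.hom hpb F h1
    (fun K _ X₀ i f₀ x H ↦ P.pol.subsingleton_ext_one_pullback_LDelta_tensorPow' P.A P.D Gr hGr₁ hGr₂ x H (by norm_num))
    φ Fφ h1φ J e hcov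
  refine ⟨Gr'', hGr''₁, hGr''₂, Fφ, h1φ, e'', hcov'', ?_⟩
  rw [heq, hιeq]

/-- **Frame rigidifications restrict / base-change**: for the chosen pull-back `P.baseChange v` along any `v : T″ → T` (e.g. the
inclusion `U.ι` of an open of `T`), `X ×_T T″ → X → 𝐏^m_ℤ` is the morphism of a frame (§1 at ★ `baseChange_isBaseChangeVia`).
[cite: MumfordFogartyKirwan1994, Ch. 7 §2 Def. 7.5 (p. 130) and Def. 7.2 (p. 129)] -/
theorem IsFrameRigidification.baseChange (hι : P.IsFrameRigidification J ι) (v : T'' ⟶ T) :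
    (P.baseChange v).IsFrameRigidification J (pullback.fst P.A.X.hom v ≫ ι) :=
  (P.baseChange_isBaseChangeVia v).isFrameRigidification_comp hι

end Frame

/-! ## §2 Linear rigidifications (Zariski-local frames) pull back along a relation, and are local on the base -/

section Linear

variable {J} {T T'' : Scheme.{0}} {P : PolarizedAbelianSchemeWithLevel g N δ T}
  {P'' : PolarizedAbelianSchemeWithLevel g N δ T''} {u : T'' ⟶ T} {G : P''.A.X.left ⟶ P.A.X.left}
  {Ĝ : P''.D.hat.X.left ⟶ P.D.hat.X.left} {ι : P.A.X.left ⟶ projectiveSpaceInt J}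

/-- **(hBC) LINEAR RIGIDIFICATIONS PULL BACK ALONG THE MODULI RELATION** ([MumfordFogartyKirwan1994] Prop. 7.6: the functor of
linearly rigidified triples): if `ι` is a linear rigidification of `P` over a locally Noetherian `T` (Zariski-locally on `T` the
morphism of a frame of `π_*(L^Δ(λ)^{⊗3})`) and `(G, Ĝ)` exhibits `P″` over `T″` as the pull-back of `P` along `u`, then `G ≫ ι` is a
linear rigidification of `P″`: pull the cover `𝒰` of `T` back to `T″` (Mathlib `Scheme.Cover.pullback₁`); over the member
`T″ ×_T 𝒰ᵢ` the restricted triple `P″|` is a pull-back of the restricted triple `P|_{𝒰ᵢ}` (★ `exists_isBaseChangeVia_of_comp`,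
cancelling `P|_{𝒰ᵢ} → P` from `P″| → P″ → P`), so §1 applies member by member.
[cite: MumfordFogartyKirwan1994, Ch. 7 §2 Prop. 7.6 (p. 136) and Def. 7.2 (p. 129)] -/
theorem IsBaseChangeVia.isLinearRigidification_comp [IsLocallyNoetherian T] (h : P''.IsBaseChangeVia P u G Ĝ)
    (hι : P.IsLinearRigidification J ι) : P''.IsLinearRigidification J (G ≫ ι) := by
  obtain ⟨𝒰, h𝒰⟩ := hι
  refine ⟨𝒰.pullback₁ u, fun i ↦ ?_⟩
  -- `P″|_{u⁻¹𝒰ᵢ} → P″ → P`, a relation along `pullback.fst ≫ u = pullback.snd ≫ 𝒰.f i`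
  have hrel : (P''.baseChange ((𝒰.pullback₁ u).f i)).IsBaseChangeVia P
      (pullback.snd u (𝒰.f i) ≫ 𝒰.f i) (pullback.fst P''.A.X.hom ((𝒰.pullback₁ u).f i) ≫ G)
      (pullback.fst P''.D.hat.X.hom ((𝒰.pullback₁ u).f i) ≫ Ĝ) := by
    rw [← pullback.condition]
    exact (P''.baseChange_isBaseChangeVia _).trans h
  -- cancel `P|_{𝒰ᵢ} → P`
  obtain ⟨m, mh, hmG, -, hm⟩ := exists_isBaseChangeVia_of_comp hrel (P.baseChange_isBaseChangeVia (𝒰.f i))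
  have key := hm.isFrameRigidification_comp (h𝒰 i)
  rw [← Category.assoc, hmG, Category.assoc] at key
  exact key

/-- **Linear rigidifications restrict / base-change** along the chosen pull-back `P.baseChange v` (any `v : T″ → T`, e.g. an
open `U.ι`). [cite: MumfordFogartyKirwan1994, Ch. 7 §2 Prop. 7.6 (p. 136) and Def. 7.2 (p. 129)] -/
theorem IsLinearRigidification.baseChange [IsLocallyNoetherian T] (hι : P.IsLinearRigidification J ι) (v : T'' ⟶ T) :
    (P.baseChange v).IsLinearRigidification J (pullback.fst P.A.X.hom v ≫ ι) :=
  (P.baseChange_isBaseChangeVia v).isLinearRigidification_comp hι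

/-- **A global frame rigidification is a linear rigidification** (the one-member cover `𝟙_T`; the restricted triple
`P.baseChange (𝟙 T)` is related to `P` along `𝟙`, §1). [cite: MumfordFogartyKirwan1994, Ch. 7 §2 Def. 7.5 (p. 130)] -/
theorem IsFrameRigidification.isLinearRigidification [IsLocallyNoetherian T] (hι : P.IsFrameRigidification J ι) :
    P.IsLinearRigidification J ι :=
  ⟨Scheme.coverOfIsIso (P := @IsOpenImmersion) (𝟙 T), fun _ ↦ hι.baseChange (𝟙 T)⟩

/-- **Being a linear rigidification is ZARISKI-LOCAL on the base**: if on the members of an open cover `𝒰` of `T` the restrictions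
`X ×_T 𝒰ᵢ → X → 𝐏^m_ℤ` of `ι` are linear rigidifications of the restricted triples, then `ι` is a linear rigidification of `P` (bind
the local covers into a cover of `T`; on a member `𝒱ᵢⱼ → 𝒰ᵢ → T` the restricted triple `P|_{𝒱ᵢⱼ}` is related along `𝟙` to
`(P|_{𝒰ᵢ})|_{𝒱ᵢⱼ}` by ★ `exists_isBaseChangeVia_of_comp`, and §1 transports the frame).  The input of the (8γ) existence gluing.
[cite: MumfordFogartyKirwan1994, Ch. 7 §2 Prop. 7.6 (p. 136)] -/
theorem IsLinearRigidification.of_openCover [IsLocallyNoetherian T] (𝒰 : Scheme.OpenCover.{0} T)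
    (h : ∀ i, (P.baseChange (𝒰.f i)).IsLinearRigidification J (pullback.fst P.A.X.hom (𝒰.f i) ≫ ι)) :
    P.IsLinearRigidification J ι := by
  choose 𝒱 h𝒱 using h
  refine ⟨𝒰.bind 𝒱, fun ij ↦ ?_⟩
  obtain ⟨i, j⟩ := ij
  -- `P|_{𝒱ᵢⱼ ≫ 𝒰ᵢ}` is related along `𝟙` to `(P|_{𝒰ᵢ})|_{𝒱ᵢⱼ}`: cancel `(P|_{𝒰ᵢ})|_{𝒱ᵢⱼ} → P|_{𝒰ᵢ} → P` against `P|_{𝒱 ≫ 𝒰} → P`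
  have hrel : (((P.baseChange (𝒰.f i)).baseChange ((𝒱 i).f j))).IsBaseChangeVia P ((𝒱 i).f j ≫ 𝒰.f i)
      (pullback.fst _ ((𝒱 i).f j) ≫ pullback.fst P.A.X.hom (𝒰.f i))
      (pullback.fst _ ((𝒱 i).f j) ≫ pullback.fst P.D.hat.X.hom (𝒰.f i)) :=
    ((P.baseChange (𝒰.f i)).baseChange_isBaseChangeVia ((𝒱 i).f j)).trans (P.baseChange_isBaseChangeVia (𝒰.f i))
  have hrel' : (P.baseChange ((𝒱 i).f j ≫ 𝒰.f i)).IsBaseChangeVia P (𝟙 _ ≫ ((𝒱 i).f j ≫ 𝒰.f i))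
      (pullback.fst P.A.X.hom ((𝒱 i).f j ≫ 𝒰.f i)) (pullback.fst P.D.hat.X.hom ((𝒱 i).f j ≫ 𝒰.f i)) := by
    rw [Category.id_comp]
    exact P.baseChange_isBaseChangeVia _
  obtain ⟨m, mh, hmG, -, hm⟩ := exists_isBaseChangeVia_of_comp hrel' hrel
  have key := hm.isFrameRigidification_comp (h𝒱 i j)
  exact (reassoc_of% hmG) ι ▸ key

end Linear

end PolarizedAbelianSchemeWithLevel

end Literature.AlgebraicGeometry.AbelianSchemes

end
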